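import Summits.BirchSwinnertonDyer.Rank1Residual.X2.GreenbergVatsalTateDatumSign
import Summits.BirchSwinnertonDyer.Rank1Residual.X2.GreenbergVatsalStrictAtP
import HarnessLib

/-!
# Greenberg's local condition at a SPLIT `p ‖ N` over `ℚ_∞^{cyc}`: the TRIVIAL ZERO in the kernel —
# `strictKer = greenbergKer ⊓ ker(evaluation at Frobenius)`, and the quotient
# `greenbergKer / strictKer` EMBEDS in `D = E[p^∞]/C ≅ ℚ_p/ℤ_p` (GV p. 15: "`S_{E[p^∞]}(ℚ_∞)` is
# actually bigger … trivial zero"; `e_p ≤ 1`)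

HONEST FRAMING (cell `b2b-bsdres`, run/shared/lean/b2b/bsd-rank1-residual/, verbatim in every
file): the goal of the cell is to DELETE the COMBINATION-SHAPED residual classes of the
Birch–Swinnerton-Dyer formula for ALL analytic-rank `≤ 1` elliptic curves over `ℚ` — "full BSD
formula for every rank `≤ 1` curve in class `C`" assembled STRICTLY from published theorems — so
that the rank-`≤ 1` remainder becomes exactly the CONSTRUCTION-SHAPED classes, which are TYPED
(missing-input `Prop`s), NOT attempted. This is not "finishing BSD". Sub-cell
`b2b-bsdres-eisenstein-p2` (CLASS-OWNERS row "X2"), gen 12: research route; NO CLAIM BEYOND STATED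
CLASSES; nothing here changes a label. THEOREMS ONLY (no `def`, no NEW named fact); §4 is
CONDITIONAL on the tree's named fact `Silverman1994_thmV53_tateUniformisation` (Silverman *ATAEC*
V.3.1 (c),(d) + V.5.3 (a),(b), PUBLISHED; hypothesis `hT`) exactly as gen 9's Tate-datum files.

WHY (X2-GAP §16.6 (P5), split half; companion of `GreenbergVatsalStrictAtNonsplit`).
Greenberg–Vatsal 2000 pp. 14–15: at a SPLIT multiplicative `p` the Tate datum has `D ≅ ℚ_p/ℤ_p`
with TRIVIAL `G_{ℚ_p}`-action, so `H¹(G_𝔭/I_𝔭, D) = D ≠ 0` and the inertia-form condition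
`L_𝔭 = ker(→ H¹(I_𝔭, D))` (tree `greenbergKer`; GV's `S_A`) is WEAKER than the strict condition
`ker(→ H¹(G_𝔭, D))` (tree `strictKer`; = `Sel_E` by Greenberg LNM 1716 p. 76): "`Sel_E(ℚ_∞)_p`
coincides with the 'strict' Selmer group … But `S_{E[p^∞]}(ℚ_∞)` is actually bigger. This
corresponds to the fact that the associated `p`-adic L-function has a trivial zero." THIS FILE
measures the difference EXACTLY at the level of the local condition:
* §1 (pure group theory, the `d = 0` twin of
  `GreenbergVatsalStrictCore.exists_eq_smul_sub_of_vanishing_on_inertia_of_surjective`): in the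
  totally ramified tower a continuous cocycle of `P = Gal(K̄_v/K_{∞,η})` vanishing on `P ∩ I` AND at
  a Frobenius `φ ∈ P` vanishes identically (`eq_zero_of_vanishing_on_inertia_of_apply_frob_eq_zero`);
* §2 (any datum with `D_v` acting trivially on `D`): cocycle criteria — `f mod M⁺` is a
  HOMOMORPHISM on `H ⊓ D_v`; `[f] ∈ greenbergKer ↔ f mod M⁺ = 0 on H ⊓ I_v`;
  `[f] ∈ strictKer ↔ f mod M⁺ = 0 on H ⊓ D_v`;
* §3 over `ℚ_∞^{cyc}` for such a datum of `E/ℚ` at `v ∋ p`: **`mem_strictKer_iff_mem_greenbergKer_and_apply_frob`**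
  — `[f] ∈ strictKer ↔ [f] ∈ greenbergKer ∧ f(Frob) ∈ M⁺` for any arithmetic Frobenius in
  `Gal(ℚ̄_p/ℚ_{∞,𝔭})`; **`exists_addMonoidHom_apply_eq_zero_iff_of_trivial`** — an additive
  `e : greenbergKer → D` (evaluation at Frobenius) with `e c = 0 ↔ c ∈ strictKer`: the quotient
  `greenbergKer/strictKer` EMBEDS in `D` (for the Tate datum `D ≅ ℚ_p/ℤ_p`: `𝒪`-corank `≤ 1`, the
  `e_p ≤ 1` of the trivial zero; EQUALITY `e_p = 1` is GV Prop. (2.1)'s surjectivity, printed, not here);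
* §4 from the named fact at a SPLIT `p ‖ N`: such a datum (Tate datum of the untwisted
  parametrisation; `D_v` acts trivially by gen 12 `GreenbergVatsalTateDatumSign.smul_gr_eq_of_equivariant`)
  EXISTS, with GV's `htriv`, the Kummer compatibility and the embedding `e`.

References: Greenberg–Vatsal 2000 §2 pp. 14–16, 19–20 (Prop. 2.1: "the kernel of `γ₀` is the
strict Selmer group"); Greenberg, LNM 1716 (1999) §2 pp. 75–76; Greenberg 1989 p. 98;
Mazur–Tate–Teitelbaum 1986 (trivial zero); Serre, *Local Fields* XIII §1.
-/

noncomputable section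

open scoped Classical NNReal Pointwise

universe u

namespace Summit.BirchSwinnertonDyer.Rank1Residual.X2.GreenbergVatsalStrictAtSplit

open NumberField IsDedekindDomain Field Literature.NumberTheory.GaloisRepresentations
  Literature.NumberTheory.EllipticCurves Literature.NumberTheory.EllipticCurves.GreenbergSelmer
  Literature.NumberTheory.EllipticCurves.ResKernel IsDedekindDomain.HeightOneSpectrum
  Summit.BirchSwinnertonDyer.Rank1Residual.X2.GreenbergVatsalTorsion
  Summit.BirchSwinnertonDyer.Rank1Residual.X2.GreenbergVatsalTateDatum
  Summit.BirchSwinnertonDyer.Rank1Residual.X2.GreenbergVatsalTateDatumSign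
  Summit.BirchSwinnertonDyer.Rank1Residual.X2.GreenbergVatsalStrictCore
  Summit.BirchSwinnertonDyer.Rank1Residual.X2.GreenbergVatsalStrictAtPQuotient
  Summit.BirchSwinnertonDyer.Rank1Residual.X2.GreenbergVatsalReductionDatum

/-! ## §1. Totally ramified tower: a cocycle vanishing on inertia and at a Frobenius vanishes -/

section Abstract

variable {G : Type u} [Group G] [TopologicalSpace G] [IsTopologicalGroup G] [CompactSpace G]
  [TotallyDisconnectedSpace G]
variable {D : Type u} [AddCommGroup D] [DistribMulAction G D] [TopologicalSpace D]
  [DiscreteTopology D]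
variable {p : ℕ} [Fact p.Prime]

/-- **A continuous cocycle of `P` vanishing on `P ∩ I` and at the Frobenius `φ` is ZERO** in the
totally ramified situation of `GreenbergVatsalStrictCore` (`G` profinite, `κ : G → ℤ_p` with kernel
`P ∋ φ`, `G = φ^ℕ·I·U` for every open `U`, inertia fills the layers `hopen`, open layers
`hlayer`): the zero set of the cocycle is an open subgroup of `P` containing `φ`, `P ∩ I` and a
deep layer, hence everything — the `d = 0` twin of
`exists_eq_smul_sub_of_vanishing_on_inertia_of_surjective` (no surjectivity of `φ − 1` needed).
[cite: SerreLocalFields1979, Ch. XIII §1] [cite: GreenbergLNM1716, §2 p. 73] -/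
theorem eq_zero_of_vanishing_on_inertia_of_apply_frob_eq_zero {I P : Subgroup G} {φ : G}
    (hφP : φ ∈ P)
    (hdec : ∀ U : Subgroup G, IsOpen (U : Set G) → ∀ d : G,
      ∃ (n : ℕ) (i u : G), i ∈ I ∧ u ∈ U ∧ d = φ ^ n * i * u)
    (κ : G →* Multiplicative ℤ_[p]) (hP : ∀ {x : G}, x ∈ P ↔ κ x = 1)
    (hopen : ∀ U : Subgroup G, U.Normal → IsOpen (U : Set G) → ∃ B : ℕ, ∀ u : G,
      (p : ℤ_[p]) ^ B ∣ (κ u).toAdd → ∃ w ∈ U, w ∈ I ∧ κ w = κ u)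
    (hlayer : ∀ B : ℕ, ∃ V : Subgroup G, IsOpen (V : Set G) ∧
      ∀ v ∈ V, (p : ℤ_[p]) ^ B ∣ (κ v).toAdd)
    (g : contOneCocycles (discreteTopRep P D)) (hg : ∀ x : P, (x : G) ∈ I → g.1 x = 0)
    (hgφ : g.1 ⟨φ, hφP⟩ = 0) (x : P) : g.1 x = 0 := by
  set Z := zeroSubgroup g with hZ
  have hZφ : (⟨φ, hφP⟩ : P) ∈ Z := by rw [mem_zeroSubgroup_iff]; exact hgφ
  have hZI : ∀ x : P, (x : G) ∈ I → x ∈ Z := fun x hx ↦ by rw [mem_zeroSubgroup_iff]; exact hg x hx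
  -- an open normal `U` with `U ∩ P ⊆ Z`
  have hz : IsOpen (Z : Set P) := isOpen_zeroSubgroup _
  obtain ⟨O, hO, hOeq⟩ := isOpen_induced_iff.mp hz
  have h1O : (1 : G) ∈ O := by
    have : (1 : P) ∈ Subtype.val ⁻¹' O := by rw [hOeq]; exact Z.one_mem
    exact this
  obtain ⟨Un, hUn⟩ := ProfiniteGrp.exist_openNormalSubgroup_sub_open_nhds_of_one hO h1O
  have hUZ : ∀ x : P, (x : G) ∈ (Un : Set G) → x ∈ Z := fun x hx ↦ by
    have : x ∈ Subtype.val ⁻¹' O := hUn hx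
    rw [hOeq] at this
    exact this
  obtain ⟨B, hB⟩ := hopen Un.toSubgroup inferInstance Un.isOpen
  obtain ⟨V, hV, hVB⟩ := hlayer B
  suffices hxZ : x ∈ Z by rw [mem_zeroSubgroup_iff] at hxZ; exact hxZ
  obtain ⟨n, i, u, hi, hu, hx⟩ := hdec (Un.toSubgroup ⊓ V) (Un.isOpen.inter hV) x
  obtain ⟨huU, huV⟩ := Subgroup.mem_inf.1 hu
  obtain ⟨w, hwU, hwI, hκw⟩ := hB u (hVB u huV)
  have hκx : κ x = 1 := hP.1 x.2
  have hκφ : κ φ = 1 := hP.1 hφP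
  have hκiu : κ i * κ u = 1 := by
    have h := congrArg κ hx
    rw [hκx, map_mul, map_mul, map_pow, hκφ, one_pow, one_mul] at h
    exact h.symm
  have hi'P : i * w ∈ P := hP.2 (by rw [map_mul, hκw, hκiu])
  have hu'P : w⁻¹ * u ∈ P := hP.2 (by rw [map_mul, map_inv, hκw, inv_mul_cancel])
  have hi'Z : (⟨i * w, hi'P⟩ : P) ∈ Z := hZI _ (I.mul_mem hi hwI)
  have hu'Z : (⟨w⁻¹ * u, hu'P⟩ : P) ∈ Z :=
    hUZ _ (Un.toSubgroup.mul_mem (Un.toSubgroup.inv_mem hwU) huU)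
  have e : x = ⟨φ, hφP⟩ ^ n * ⟨i * w, hi'P⟩ * ⟨w⁻¹ * u, hu'P⟩ := by
    apply Subtype.ext
    simp only [Subgroup.coe_mul, SubgroupClass.coe_pow]
    rw [hx]; group
  rw [e]
  exact Z.mul_mem (Z.mul_mem (Z.pow_mem hZφ n) hi'Z) hu'Z

end Abstract

/-! ## §2. Data with `D_v` acting trivially on `D = M/M⁺`: cocycle criteria -/

section Trivial

variable {K : Type u} [Field K] [NumberField K] (H : Subgroup (absoluteGaloisGroup K)) {M : Type u}
  [AddCommGroup M] [DistribMulAction (absoluteGaloisGroup K) M] [TopologicalSpace M]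
  [DiscreteTopology M] {v : HeightOneSpectrum (𝓞 K)} (N : LocalDatum K M v)
  (htrivD : ∀ (δ : decomp (K := K) v) (d : N.Gr), δ • d = d)

include htrivD in
/-- With `D_v` trivial on `D`, **`f mod M⁺` is a homomorphism on `H ⊓ D_v`**.
[cite: GreenbergVatsal2000, §2 pp. 14–15] -/
theorem grMk_apply_mul_of_trivial (f : contOneCocycles (discreteTopRep H M)) (x y : decompIn H v) :
    N.grMk (f.1 (decompInToH H v (x * y))) =
      N.grMk (f.1 (decompInToH H v x)) + N.grMk (f.1 (decompInToH H v y)) := by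
  rw [map_mul, f.2 (decompInToH H v x) (decompInToH H v y), map_add]
  congr 1
  change N.grMk (((x : decomp (K := K) v) : absoluteGaloisGroup K) • f.1 (decompInToH H v y)) = _
  rw [← LocalDatum.smul_grMk, htrivD]

include htrivD in
/-- With `D_v` trivial on `D`: **`[f] ∈ greenbergKer ↔ f(x) ∈ M⁺` for all `x ∈ H ⊓ I_v`**.
[cite: Greenberg1989, §1 p. 98 (4)] -/
theorem mem_greenbergKer_iff_of_trivial (f : contOneCocycles (discreteTopRep H M)) :
    oneCocycleClass (discreteTopRep H M) f ∈ N.greenbergKer H ↔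
      ∀ x : inertiaIn H v, N.grMk (f.1 (inertiaInToH H v x)) = 0 := by
  rw [GreenbergVatsalSelmerLink.oneCocycleClass_mem_greenbergKer_iff]
  constructor
  · rintro ⟨q, hq⟩ x
    rw [hq x, Subgroup.smul_def, htrivD, sub_self]
  · intro h
    exact ⟨0, fun x ↦ by rw [h x, smul_zero, sub_zero]⟩

include htrivD in
/-- With `D_v` trivial on `D`: **`[f] ∈ strictKer ↔ f(x) ∈ M⁺` for all `x ∈ H ⊓ D_v`**.
[cite: Greenberg1989, §1 p. 98 ("strict")] -/
theorem mem_strictKer_iff_of_trivial (f : contOneCocycles (discreteTopRep H M)) :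
    oneCocycleClass (discreteTopRep H M) f ∈ N.strictKer H ↔
      ∀ x : decompIn H v, N.grMk (f.1 (decompInToH H v x)) = 0 := by
  rw [LocalDatum.mem_strictKer_iff, LocalDatum.strictMap, resH1Hom_oneCocycleClass,
    oneCocycleClass_eq_zero_iff]
  constructor
  · rintro ⟨q, hq⟩ x
    have h := hq x
    rw [contOneCocycles.pullback_apply] at h
    change N.grMk (f.1 (decompInToH H v x)) = x • q - q at h
    rw [h, Subgroup.smul_def, htrivD, sub_self]
  · intro h
    refine ⟨0, fun x ↦ ?_⟩
    rw [contOneCocycles.pullback_apply]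
    change N.grMk (f.1 (decompInToH H v x)) = x • (0 : N.Gr) - 0
    rw [smul_zero, sub_zero]
    exact h x

end Trivial

/-! ## §3. Over `ℚ_∞^{cyc}` at `v ∋ p`: `strictKer = greenbergKer ⊓ (f(Frob) ∈ M⁺)`; the embedding -/

section Cyclotomic

variable (W : WeierstrassCurve ℚ) [W.IsGloballyMinimal] [W.IsElliptic] (p : ℕ) [hp : Fact p.Prime]
  (κ : ZpExtension ℚ p) {v : HeightOneSpectrum (𝓞 ℚ)}
  (N : LocalDatum ℚ (W.geomPrimaryTorsion p) v)
  (htrivD : ∀ (δ : decomp (K := ℚ) v) (d : N.Gr), δ • d = d)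

/-- An arithmetic Frobenius `τ ∈ Γ_{ℚ_v}` whose restriction lies in `H = ker κ`, as an element of
`H ⊓ D_v`. [folklore] -/
theorem absGaloisRestrict_mem_decompIn {τ : absoluteGaloisGroup (v.adicCompletion ℚ)}
    (hτH : resGal (K := ℚ) (v.adicCompletion ℚ) τ ∈ κ.kerSubgroup) :
    (⟨absGaloisRestrict ℚ (v.adicCompletion ℚ) τ, ⟨τ, rfl⟩⟩ : decomp (K := ℚ) v) ∈
      decompIn κ.kerSubgroup v := by
  rw [mem_decompIn_iff]
  change absGaloisRestrict ℚ (v.adicCompletion ℚ) τ ∈ κ.kerSubgroup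
  rw [← WeierstrassCurve.resGal_eq_absGaloisRestrict]; exact hτH

omit [W.IsGloballyMinimal] [W.IsElliptic] in
include htrivD in
/-- **`strictKer = greenbergKer ⊓ (f(Frob) ∈ M⁺)` over `ℚ_∞^{cyc}`** for a datum of `E/ℚ` at
`v ∋ p` on whose quotient `D` the decomposition group acts TRIVIALLY (the split Tate datum): for
`κ` cyclotomic and ANY arithmetic Frobenius `τ ∈ Γ_{ℚ_v}` with `res τ ∈ ker κ` (they exist:
`ZpExtension.IsCyclotomic.exists_isArithFrobAt_resGal_mem_kerSubgroup`), a class `[f]` satisfies the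
strict condition iff it satisfies Greenberg's condition AND `f(res τ) ∈ M⁺`. (`←`: `f mod M⁺` on
`H ⊓ D_v` is a continuous homomorphism killed on `H ⊓ I_v` and at the Frobenius, hence zero by
§1 with gen 10's Frobenius generation / layer-filling.) So `greenbergKer/strictKer` is detected by
ONE value in `D ≅ ℚ_p/ℤ_p` — the trivial-zero defect `e_p ≤ 1` of GV p. 15.
[cite: GreenbergVatsal2000, §2 pp. 14–16] [cite: GreenbergLNM1716, §2 pp. 73–76] -/
theorem mem_strictKer_iff_mem_greenbergKer_and_apply_frob (hκ : κ.IsCyclotomic)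
    (hpv : ((p : ℕ) : 𝓞 ℚ) ∈ v.asIdeal) {𝔐 : Ideal v.localAbsIntegers} (h𝔐 : 𝔐 ∈ v.localPrimesAbove)
    {τ : absoluteGaloisGroup (v.adicCompletion ℚ)}
    (hτ : IsArithFrobAt (v.adicCompletionIntegers ℚ) τ 𝔐)
    (hτH : resGal (K := ℚ) (v.adicCompletion ℚ) τ ∈ κ.kerSubgroup)
    (f : contOneCocycles (discreteTopRep κ.kerSubgroup (W.geomPrimaryTorsion p))) :
    oneCocycleClass (discreteTopRep κ.kerSubgroup (W.geomPrimaryTorsion p)) f ∈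
        N.strictKer κ.kerSubgroup ↔
      oneCocycleClass (discreteTopRep κ.kerSubgroup (W.geomPrimaryTorsion p)) f ∈
          N.greenbergKer κ.kerSubgroup ∧
        N.grMk (f.1 ⟨resGal (K := ℚ) (v.adicCompletion ℚ) τ, hτH⟩) = 0 := by
  set φ₀ : decomp (K := ℚ) v := ⟨absGaloisRestrict ℚ (v.adicCompletion ℚ) τ, ⟨τ, rfl⟩⟩ with hφ₀
  have hφ₀P : φ₀ ∈ decompIn κ.kerSubgroup v := absGaloisRestrict_mem_decompIn p κ hτH
  have eφ : decompInToH κ.kerSubgroup v ⟨φ₀, hφ₀P⟩ =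
      ⟨resGal (K := ℚ) (v.adicCompletion ℚ) τ, hτH⟩ := Subtype.ext rfl
  constructor
  · intro hc
    refine ⟨N.strictKer_le_greenbergKer κ.kerSubgroup hc, ?_⟩
    rw [← eφ]
    exact (mem_strictKer_iff_of_trivial κ.kerSubgroup N htrivD f).1 hc ⟨φ₀, hφ₀P⟩
  · rintro ⟨hc, hφ⟩
    rw [mem_strictKer_iff_of_trivial κ.kerSubgroup N htrivD f]
    have hI := (mem_greenbergKer_iff_of_trivial κ.kerSubgroup N htrivD f).1 hc
    haveI := compactSpace_decomp (K := ℚ) v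
    -- the homomorphism `f mod M⁺` on `H ⊓ D_v`, as a cocycle with values in `D`
    set g : contOneCocycles (discreteTopRep (decompIn κ.kerSubgroup v) N.Gr) :=
      contOneCocycles.pullback (decompInToH κ.kerSubgroup v)
        (resHomOfEquivariant _ N.grMk fun _ _ ↦ rfl) f with hgdef
    have hg_apply : ∀ x, g.1 x = N.grMk (f.1 (decompInToH κ.kerSubgroup v x)) := fun x ↦ by
      rw [hgdef, contOneCocycles.pullback_apply]; rfl
    intro x
    rw [← hg_apply]
    refine eq_zero_of_vanishing_on_inertia_of_apply_frob_eq_zero (G := decomp (K := ℚ) v)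
      (D := N.Gr) (p := p) (I := (inertia v).subgroupOf (decomp v)) (P := decompIn κ.kerSubgroup v)
      hφ₀P
      (fun U hU d ↦ by
        obtain ⟨n, i, u, hi, hu, hd⟩ := exists_eq_frob_pow_mul_of_decomp v (specVal_spec v) h𝔐 hτ U hU d
        exact ⟨n, i, u, (Subgroup.mem_subgroupOf).2 hi, hu, hd⟩)
      (κ.toContinuousMonoidHom.toMonoidHom.comp (decomp v).subtype)
      (fun {x} ↦ by
        rw [mem_decompIn_iff, ZpExtension.mem_kerSubgroup]; rfl)
      (fun U hUn hU ↦ by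
        haveI := hUn
        obtain ⟨B, hB⟩ := exists_layer_le_kappa_inertia κ v hκ hpv U hU
        refine ⟨B, fun u hu ↦ ?_⟩
        obtain ⟨w, hwU, hwI, hκw⟩ := hB u hu
        exact ⟨w, hwU, (Subgroup.mem_subgroupOf).2 hwI, hκw⟩)
      (fun B ↦ exists_open_layer κ v B)
      g
      (fun y hyI ↦ by
        rw [hg_apply]
        have hyH : ((y : decomp (K := ℚ) v) : absoluteGaloisGroup ℚ) ∈ κ.kerSubgroup :=
          (mem_decompIn_iff κ.kerSubgroup v _).1 y.2
        set y' : inertiaIn κ.kerSubgroup v := ⟨(y : decomp (K := ℚ) v),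
          (mem_inertiaIn_iff κ.kerSubgroup v _).2 ⟨hyH, (Subgroup.mem_subgroupOf).1 hyI⟩⟩ with hy'
        have e1 : inertiaInToH κ.kerSubgroup v y' = decompInToH κ.kerSubgroup v y := Subtype.ext rfl
        rw [← e1]
        exact hI y')
      (by rw [hg_apply, eφ]; exact hφ)
      x

omit [W.IsGloballyMinimal] [W.IsElliptic] in
include htrivD in
/-- **The quotient `greenbergKer/strictKer` EMBEDS in `D`** (over `ℚ_∞^{cyc}`, datum with trivial
`D_v`-action on `D`, `κ` cyclotomic): there is an additive map `e : greenbergKer → D` — evaluation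
of any cocycle representative at an arithmetic Frobenius of `Gal(ℚ̄_p/ℚ_{∞,𝔭})`, well defined
because principal cocycles die in `D` — with `e c = 0 ↔ c ∈ strictKer`. For the split Tate datum
`D ≅ ℚ_p/ℤ_p`, so `S_A/S^{str}_A` has `𝒪`-corank `≤ 1`: the trivial-zero shift `e_p ≤ 1`
(GV pp. 14–15; `= 1` is GV Prop. (2.1), printed). [cite: GreenbergVatsal2000, §2 pp. 14–16, 19–20] -/
theorem exists_addMonoidHom_apply_eq_zero_iff_of_trivial (hκ : κ.IsCyclotomic)
    (hpv : ((p : ℕ) : 𝓞 ℚ) ∈ v.asIdeal) :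
    ∃ e : N.greenbergKer κ.kerSubgroup →+ N.Gr,
      ∀ c : N.greenbergKer κ.kerSubgroup,
        e c = 0 ↔ (c : W.subgroupH1 p κ.kerSubgroup) ∈ N.strictKer κ.kerSubgroup := by
  obtain ⟨𝔐, h𝔐⟩ := v.localPrimesAbove_nonempty
  have hϖ := IsDedekindDomain.HeightOneSpectrum.irreducible_natCast_adicCompletionIntegers_rat hpv
  obtain ⟨τ, hτ, hτH⟩ := hκ.exists_isArithFrobAt_resGal_mem_kerSubgroup (specVal_spec v) h𝔐 hpv hϖ
  set φH : κ.kerSubgroup := ⟨resGal (K := ℚ) (v.adicCompletion ℚ) τ, hτH⟩ with hφH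
  have hφD : (φH : absoluteGaloisGroup ℚ) ∈ decomp v := by
    change resGal (K := ℚ) (v.adicCompletion ℚ) τ ∈ decomp v
    rw [WeierstrassCurve.resGal_eq_absGaloisRestrict]; exact ⟨τ, rfl⟩
  -- representatives
  set X := discreteTopRep κ.kerSubgroup (W.geomPrimaryTorsion p) with hX
  choose rep hrep using oneCocycleClass_surjective X
  -- the value at Frobenius only depends on the class
  have hval : ∀ f f' : contOneCocycles X, oneCocycleClass X f = oneCocycleClass X f' →
      N.grMk (f.1 φH) = N.grMk (f'.1 φH) := by
    intro f f' hff'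
    have h0 : oneCocycleClass X (f - f') = 0 := by rw [oneCocycleClass_sub, hff', sub_self]
    obtain ⟨m, hm⟩ := (oneCocycleClass_eq_zero_iff X _).1 h0
    have h1 : (f - f').1 φH = f.1 φH - f'.1 φH := rfl
    have h2 := hm φH
    rw [h1] at h2
    rw [← sub_eq_zero, ← map_sub, h2]
    change N.grMk ((φH : absoluteGaloisGroup ℚ) • m - m) = 0
    rw [map_sub, sub_eq_zero, ← LocalDatum.smul_grMk N ⟨_, hφD⟩ m, htrivD]
  refine ⟨AddMonoidHom.mk' (fun c ↦ N.grMk ((rep c.1).1 φH)) ?_, fun c ↦ ?_⟩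
  · intro c₁ c₂
    change N.grMk ((rep (c₁.1 + c₂.1)).1 φH) = N.grMk ((rep c₁.1).1 φH) + N.grMk ((rep c₂.1).1 φH)
    rw [hval (rep (c₁.1 + c₂.1)) (rep c₁.1 + rep c₂.1)
      (by rw [hrep, oneCocycleClass_add, hrep, hrep]), ← map_add]
    rfl
  · change N.grMk ((rep c.1).1 φH) = 0 ↔ _
    have key := mem_strictKer_iff_mem_greenbergKer_and_apply_frob W p κ N htrivD hκ hpv h𝔐 hτ hτH
      (rep c.1)
    rw [hrep] at key
    rw [key]
    exact ⟨fun h ↦ ⟨c.2, h⟩, fun h ↦ h.2⟩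

end Cyclotomic

/-! ## §4. The split Tate datum from the named fact -/

section Facts

variable (W : WeierstrassCurve ℚ) [W.IsGloballyMinimal] [W.IsElliptic] (p : ℕ) [hp : Fact p.Prime]
  (κ : ZpExtension ℚ p) {v : HeightOneSpectrum (𝓞 ℚ)}

omit [W.IsGloballyMinimal] in
/-- **At a SPLIT `p ‖ N` there is a Greenberg datum at `v ∋ p` on whose quotient `D` the whole
decomposition group acts TRIVIALLY**, satisfying GV's "`I_p` trivial on `D`", the Kummer
compatibility (`Sel ⊆ S`), and — over `ℚ_∞^{cyc}` — admitting the embedding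
`e : greenbergKer → D`, `e c = 0 ↔ c ∈ strictKer` of the trivial zero; granted the PUBLISHED Tate
uniformisation (`hT` = `Silverman1994_thmV53_tateUniformisation`, Silverman *ATAEC* V.3.1/V.5.3):
the Tate datum of the (untwisted, `Γ_{ℚ_p}`-equivariant) parametrisation.
[cite: SilvermanATAEC1994, Ch. V Thm. 3.1 (c),(d) p. 423 and §V.5 Thm. 5.3 (a),(b)]
[cite: GreenbergVatsal2000, §2 pp. 14–16] -/
theorem exists_datum_trivial_of_split (hT : Silverman1994_thmV53_tateUniformisation.{0})
    (hκ : κ.IsCyclotomic) (hsplit : W.HasSplitMultiplicativeReductionAt v)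
    (hpv : ((p : ℕ) : 𝓞 ℚ) ∈ v.asIdeal) :
    ∃ N : LocalDatum ℚ (W.geomPrimaryTorsion p) v,
      (∀ x ∈ inertia v, ∀ m : W.geomPrimaryTorsion p, x • m - m ∈ N.plus) ∧
      (∀ σ ∈ absInertia (v.adicCompletion ℚ), ∀ (P : localPoints W (v.adicCompletion ℚ))
        (m : W.geomPrimaryTorsion p),
        pointsMap W (v.adicCompletion ℚ) (m : W.geomPoints) = σ • P - P → m ∈ N.plus) ∧
      (∀ (δ : decomp (K := ℚ) v) (d : N.Gr), δ • d = d) ∧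
      ∃ e : N.greenbergKer κ.kerSubgroup →+ N.Gr,
        ∀ c : N.greenbergKer κ.kerSubgroup,
          e c = 0 ↔ (c : W.subgroupH1 p κ.kerSubgroup) ∈ N.strictKer κ.kerSubgroup := by
  obtain ⟨q, Φ, hq0, hq1, hsurj, hker, hΦσ, -⟩ := hT W v hsplit
  set N := tateDatum W p Φ (sign_disj W Φ 0 (sign_of_equivariant W Φ hΦσ)) with hN
  have htrivD : ∀ (δ : decomp (K := ℚ) v) (d : N.Gr), δ • d = d :=
    smul_gr_eq_of_equivariant W p Φ hΦσ hsurj (fun u h ↦ (hker u).1 h)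
  exact ⟨N, tateDatum_htriv W p Φ _ hsurj (fun u h ↦ (hker u).1 h) (fun σ _ u ↦ hΦσ σ u),
    tateDatum_kummer W p Φ _ hsurj (fun u h ↦ (hker u).1 h) (fun σ _ u ↦ hΦσ σ u) hq0 hq1,
    htrivD, exists_addMonoidHom_apply_eq_zero_iff_of_trivial W p κ N htrivD hκ hpv⟩

end Facts

end Summit.BirchSwinnertonDyer.Rank1Residual.X2.GreenbergVatsalStrictAtSplit

end
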